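import Mathlib
import HarnessLib
import Literature.Probability.MarkovChains.GroupInverse
import Literature.Probability.MarkovChains.ErgodicityCoefficient

/-!
# Condition numbers of a finite Markov chain: `‖π̃ − π‖ ≤ ‖P̃ − P‖_∞ · {τ(Q#), κ(T), ‖Z‖_∞, ‖Q#‖_∞}` and the size of `P̃ − P` for an accept/reject chain

HONEST FRAMING: exact (Metropolis-corrected) sampling algorithms for lattice gauge theory; figures
of merit are autocorrelation/cost numbers at stated couplings and volumes; no continuum-physics claim.

Conventions as in `GroupInverse.lean` / `ErgodicityCoefficient.lean`; "`‖E‖_∞ ≤ ε`" for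
`E = P̃ − P` is written `∀ x, Σ_y |P̃ x y − P x y| ≤ ε`.  `π` is the stationary distribution of
an irreducible row-stochastic `P` (hypotheses `IsRowStochastic P`, `Σπ = 1`, `IsStationary π P`,
`IsUnit (1 − (P − limitMatrix π))` — the last from `isUnit_fundamentalInv` for irreducible `P`),
`π̃ ≥ 0` with `Σπ̃ = 1` is stationary for an ARBITRARY `P̃`.

* `norm_sub_le_mul_ergodicCoeff_groupInv` — **KN THEOREM 5.3.5 (a)** (Seneta 1991):
  `‖π̃ − π‖₁ ≤ ‖E‖_∞ τ(Q#)` [cite: KirklandNeumann2012, §5.3 Theorem 5.3.5 (a), eq. (5.16)];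
  `tvDist_le_mul_ergodicCoeff_groupInv` (total-variation form); `ergodicCoeff_groupInv`
  (`τ(Q#) = τ(Z)`); the NORM-WISE condition numbers `norm_sub_le_mul_row_norm_groupInv`
  (`‖π̃ − π‖₁ ≤ ‖E‖_∞‖Q#‖_∞`, Meyer 1980) and `norm_sub_le_mul_row_norm_fundamentalMatrix`
  (`≤ ‖E‖_∞‖Z‖_∞`, Schweitzer 1968) [cite: KirklandNeumann2012, §5.3 eqs. (5.11)–(5.12)];
* `groupInv_apply_le_diag` — **KN PROPOSITION 2.5.1** (Meyer): the maximal entry of every COLUMN of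
  `Q#` is the diagonal one [cite: KirklandNeumann2012, §2.5 Proposition 2.5.1] (maximum-principle
  proof: the `k`-th column `u` solves `u − Pu = e_k − π_k 1`);
* `condKappa π P = ½ max_{i,j} (q#_jj − q#_ij)` — THE CONDITION NUMBER `κ(T)`
  [cite: KirklandNeumann2012, §5.3 eq. (5.15)] and `abs_sub_apply_le_mul_condKappa` —
  **KN THEOREM 5.3.5 (b)** (Haviv–Van der Heyden 1984): `|π̃_k − π_k| ≤ ‖E‖_∞ κ(T)` for every `k`
  [cite: KirklandNeumann2012, §5.3 Theorem 5.3.5 (b), eq. (5.17); equality in Example 5.3.8];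
* (append, § Kemeny) `groupInv_diag_nonneg`, `ergodicCoeff_groupInv_le_trace` — **KN COROLLARY 5.3.9**:
  `τ(Q#) ≤ trace Q#` (the KEMENY CONSTANT `Σ_{k≥2} 1/(1 − λ_k) = trace Q#` of the exact chain is a
  condition number; proof as printed: `½Σ_k|q#_ik − q#_jk| = Σ_k max(q#_ik, q#_jk) ≤ Σ_k q#_kk`), and
  `norm_sub_le_mul_trace_groupInv` (`‖π̃ − π‖₁ ≤ ‖E‖_∞ · trace Q#`) [cite: KirklandNeumann2012, §5.3
  Corollary 5.3.9];
* `tvDist_le_div_of_ergodicCoeff_le` — Seneta's 1988 bound under a DOEBLIN constant `δ`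
  (`τ(P) ≤ 1 − δ`): `‖π̃ − π‖₁ ≤ ‖E‖_∞/δ`, `‖π̃ − π‖_TV ≤ ‖E‖_∞/(2δ)` [cite: FasinoTudisco2020,
  §4.1 Theorems 2 and 4];
* `rateKernel R` — the accept/reject shape (off-diagonal rates, compensating diagonal;
  `mhKernel T π = rateKernel (mhRate T π)`); `rowDiff_rateKernel_le` —
  `‖K̂(x,·) − K(x,·)‖₁ ≤ 2 Σ_{y≠x} |R̂ x y − R x y|`; `rowDiff_rateKernel_accept_le` —
  **ALQUIER–FRIEL–EVERITT–BOLAND**: a common proposal `T` and acceptance probabilities with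
  `|â − a| ≤ δ` give `‖K̂ − K‖_∞ ≤ 2δ` (kernel total-variation distance `≤ δ`)
  [cite: AlquierEtAl2014, §2.1.1 Corollary 2.3 and its proof].

Everything is PROVED (0 named facts).  The originals behind the book's statements — Meyer 1980
(`‖A#‖_∞`, Lemma 5.3.1), Schweitzer 1968 (`‖Z‖_∞`), Seneta 1991 (`τ(Q#)`), Haviv–Van der Heyden
1984 (`κ`), and Cho–Meyer 2001 (the comparison of the eight condition numbers) — are named with the
locator of the RESTATEMENT that was read [cite: KirklandNeumann2012, §5.3 and bibliography [23],
[53], [95], [108]]; they were not read in the original.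

Context (cell pub-lqcd, row 38 `r2-scope`, R2-SCOPE.md §3 E5 "accept-step solver residual", E4 /
X-5c "regulated operator in the accept step", §5.3 detector (V1-R2) thresholds): an exact kernel
implemented with an accept-step defect of at most `δ` in acceptance probability is a perturbation
with `‖E‖_∞ ≤ 2δ` (`rowDiff_rateKernel_accept_le`), so the stationary law of the chain actually
run is within `δ τ(Q#)` of `π` in total variation (`tvDist_le_mul_ergodicCoeff_groupInv`), or
within `δ/δ₀` under a Doeblin constant `δ₀` (`tvDist_le_div_of_ergodicCoeff_le`, from Seneta's
1988 bound of `ErgodicityCoefficient.lean`) — first order in the defect, the exact chain's own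
condition number being the constant.  Nothing here is specific to lattice field theory.

## References

* S. J. Kirkland, M. Neumann, *Group Inverses of M-Matrices and Their Applications*, CRC Press
  2012, §2.5 Proposition 2.5.1, §5.3 eqs. (5.11)–(5.17), Theorem 5.3.5, Remark 5.3.6, Example
  5.3.8, Corollary 5.3.9 [KirklandNeumann2012].
* P. Alquier, N. Friel, R. Everitt, A. Boland, *Noisy Monte Carlo: convergence of Markov chains with
  approximate transition kernels*, Stat. Comput. 26 (2016) 29–47 = arXiv:1403.5496, §2.1.1
  Corollary 2.3 and its proof [AlquierEtAl2014].
* D. Fasino, F. Tudisco, SIAM J. Math. Data Sci. 2 (2020), §4.1 Theorem 1 [FasinoTudisco2020].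
* Originals (not read; cited via the book): P. J. Schweitzer 1968 [Schweitzer1968]; C. D. Meyer
  1980 [Meyer1980]; M. Haviv, L. Van der Heyden 1984 [HavivVanderheyden1984]; E. Seneta 1988
  [Seneta1988]; G. E. Cho, C. D. Meyer 2001 [ChoMeyer2001].
-/

namespace Literature.Probability.MarkovChains

open Finset Matrix

variable {X : Type*} [Fintype X] [DecidableEq X]

omit [DecidableEq X] in
/-- `(v M)_j = Σ_i v_i M_ij`. [folklore] -/
private theorem vecMul_apply' (v : X → ℝ) (M : Matrix X X ℝ) (j : X) :
    (v ᵥ* M) j = ∑ i, v i * M i j := rfl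

omit [DecidableEq X] in
/-- A probability vector lives on a nonempty state space. [folklore] -/
private theorem nonempty_of_sum_eq_one {π : X → ℝ} (hπ1 : ∑ x, π x = 1) : Nonempty X := by
  by_contra h
  rw [not_nonempty_iff] at h
  rw [univ_eq_empty, sum_empty] at hπ1
  exact zero_ne_one hπ1

omit [DecidableEq X] in
/-- A row-stochastic matrix preserves the total mass of a row vector. [folklore] -/
private theorem sum_vecMul_of_isRowStochastic {P : Matrix X X ℝ} (hP : IsRowStochastic P)
    (u : X → ℝ) : ∑ y, (u ᵥ* P) y = ∑ x, u x := by
  simp_rw [vecMul_apply']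
  rw [sum_comm]
  exact sum_congr rfl fun x _ => by rw [← mul_sum, hP.2 x, mul_one]

/-! ## Condition numbers: the perturbation bounds of Seneta, Haviv–Van der Heyden, Schweitzer, Meyer -/

section Bounds

variable {π π' : X → ℝ} {P P' : Matrix X X ℝ}

omit [DecidableEq X] in
/-- `π̃E = π̃ − π̃P` has zero sum when `P` is row-stochastic (whatever `P̃` is).
[cite: KirklandNeumann2012, §5.3 proof of Theorem 5.3.5 ("`Eᵗw̃` is a vector … whose entries sum
to zero")] -/
theorem sum_vecMul_sub_eq_zero [DecidableEq X] (hP : IsRowStochastic P)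
    (hst' : IsStationary π' P') : ∑ y, (π' ᵥ* (P' - P)) y = 0 := by
  rw [vecMul_sub, isStationary_iff_vecMul.1 hst']
  simp only [Pi.sub_apply, sum_sub_distrib]
  rw [sum_vecMul_of_isRowStochastic hP, sub_self]

/-- **THEOREM 5.3.5 (a) — SENETA'S CONDITION NUMBER `τ(Q#)`**: for the stationary distribution
`π` of an irreducible row-stochastic `P` and the stationary probability vector `π̃` of any `P̃`
with `‖P̃ − P‖_∞ ≤ ε` (absolute row sums), `‖π̃ − π‖₁ ≤ ε · τ(Q#)`.
[cite: KirklandNeumann2012, §5.3 Theorem 5.3.5 (a), eq. (5.16) (due to Seneta [108] = Seneta 1991)] -/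
theorem norm_sub_le_mul_ergodicCoeff_groupInv (hP : IsRowStochastic P) (hπ1 : ∑ x, π x = 1)
    (hst : IsStationary π P) (hK : IsUnit (1 - (P - limitMatrix π)))
    (hπ'0 : ∀ x, 0 ≤ π' x) (hπ'1 : ∑ x, π' x = 1) (hst' : IsStationary π' P')
    {ε : ℝ} (hE : ∀ x, ∑ y, |P' x y - P x y| ≤ ε) :
    ∑ y, |π' y - π y| ≤ ε * ergodicCoeff (groupInv π P) := by
  have hid := sub_eq_vecMul_vecMul_groupInv hP hπ1 hst hK hπ'1 hst'
  calc ∑ y, |π' y - π y| = ∑ y, |(π' ᵥ* (P' - P) ᵥ* groupInv π P) y| := by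
        rw [← hid]; rfl
    _ ≤ (∑ y, |(π' ᵥ* (P' - P)) y|) * ergodicCoeff (groupInv π P) :=
        norm_vecMul_le_mul_ergodicCoeff (sum_vecMul_sub_eq_zero hP hst') _
    _ ≤ ε * ergodicCoeff (groupInv π P) :=
        mul_le_mul_of_nonneg_right (norm_vecMul_sub_le hπ'0 hπ'1 hE) (ergodicCoeff_nonneg _)

/-- The same in total variation: `‖π̃ − π‖_TV ≤ (ε/2) · τ(Q#)`.
[cite: KirklandNeumann2012, §5.3 Theorem 5.3.5 (a), eq. (5.16)] -/
theorem tvDist_le_mul_ergodicCoeff_groupInv (hP : IsRowStochastic P) (hπ1 : ∑ x, π x = 1)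
    (hst : IsStationary π P) (hK : IsUnit (1 - (P - limitMatrix π)))
    (hπ'0 : ∀ x, 0 ≤ π' x) (hπ'1 : ∑ x, π' x = 1) (hst' : IsStationary π' P')
    {ε : ℝ} (hE : ∀ x, ∑ y, |P' x y - P x y| ≤ ε) :
    tvDist π' π ≤ ε / 2 * ergodicCoeff (groupInv π P) := by
  have h := norm_sub_le_mul_ergodicCoeff_groupInv hP hπ1 hst hK hπ'0 hπ'1 hst' hE
  unfold tvDist
  linarith

/-- `τ(Q#) = τ(Z)`: the limiting matrix has identical rows, so row DIFFERENCES of `Z` and of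
`Q# = Z − 1π` coincide. [cite: KirklandNeumann2012, §5.3 eq. (5.14) with §6.1 (`(I − T)# = Z − 1wᵗ`:
the two matrices differ by a matrix with identical rows)] -/
theorem ergodicCoeff_groupInv (π : X → ℝ) (P : Matrix X X ℝ) :
    ergodicCoeff (groupInv π P) = ergodicCoeff (fundamentalMatrix π P) := by
  unfold ergodicCoeff groupInv
  congr 1
  refine iSup_congr fun p => sum_congr rfl fun k _ => ?_
  simp only [Matrix.sub_apply, limitMatrix, Matrix.of_apply]
  ring_nf

/-- **SCHWEITZER's / MEYER's NORM-WISE CONDITION NUMBERS**: since `τ(B) ≤ ‖B‖_∞`, the bound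
(5.16) implies `‖π̃ − π‖₁ ≤ ‖E‖_∞ ‖Q#‖_∞` (Meyer 1980) and, as `τ(Q#) = τ(Z)`,
`‖π̃ − π‖₁ ≤ ‖E‖_∞ ‖Z‖_∞` (Schweitzer 1968) — the inequalities "of the form (5.12)" with
`f = ‖·‖_∞` surveyed by Cho–Meyer. Here: any bound `b` on the absolute row sums of `Q#`.
[cite: KirklandNeumann2012, §5.3 eqs. (5.11)–(5.12) and the sentence "the paper of Cho and
Meyer [23] surveys eight such inequalities"]; [cite: FasinoTudisco2020, §4.1 Theorem 1] -/
theorem norm_sub_le_mul_row_norm_groupInv (hP : IsRowStochastic P) (hπ1 : ∑ x, π x = 1)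
    (hst : IsStationary π P) (hK : IsUnit (1 - (P - limitMatrix π)))
    (hπ'0 : ∀ x, 0 ≤ π' x) (hπ'1 : ∑ x, π' x = 1) (hst' : IsStationary π' P')
    {ε b : ℝ} (hE : ∀ x, ∑ y, |P' x y - P x y| ≤ ε) (hε : 0 ≤ ε)
    (hb : ∀ i, ∑ k, |groupInv π P i k| ≤ b) :
    ∑ y, |π' y - π y| ≤ ε * b := by
  haveI := nonempty_of_sum_eq_one hπ1
  exact (norm_sub_le_mul_ergodicCoeff_groupInv hP hπ1 hst hK hπ'0 hπ'1 hst' hE).trans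
    (mul_le_mul_of_nonneg_left (ergodicCoeff_le_of_row_norm_le hb) hε)

/-- Schweitzer's form: any bound `b` on the absolute row sums of the FUNDAMENTAL MATRIX `Z` is a
condition number, `‖π̃ − π‖₁ ≤ ‖E‖_∞ · b`. [cite: KirklandNeumann2012, §5.3 eqs. (5.11)–(5.12)
with §6.1 (Schweitzer's `‖Z‖_∞`, attribution per Cho–Meyer [23])]; [cite: FasinoTudisco2020, §4.1
Theorem 1] -/
theorem norm_sub_le_mul_row_norm_fundamentalMatrix (hP : IsRowStochastic P) (hπ1 : ∑ x, π x = 1)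
    (hst : IsStationary π P) (hK : IsUnit (1 - (P - limitMatrix π)))
    (hπ'0 : ∀ x, 0 ≤ π' x) (hπ'1 : ∑ x, π' x = 1) (hst' : IsStationary π' P')
    {ε b : ℝ} (hE : ∀ x, ∑ y, |P' x y - P x y| ≤ ε) (hε : 0 ≤ ε)
    (hb : ∀ i, ∑ k, |fundamentalMatrix π P i k| ≤ b) :
    ∑ y, |π' y - π y| ≤ ε * b := by
  haveI := nonempty_of_sum_eq_one hπ1
  have h := norm_sub_le_mul_ergodicCoeff_groupInv hP hπ1 hst hK hπ'0 hπ'1 hst' hE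
  rw [ergodicCoeff_groupInv] at h
  exact h.trans (mul_le_mul_of_nonneg_left (ergodicCoeff_le_of_row_norm_le hb) hε)

/-- **KN PROPOSITION 2.5.1** (Meyer): in each COLUMN of `Q# = (I − P)#` the maximal entry is the
diagonal one, `Q#_ik ≤ Q#_kk`.  Proof (maximum principle): the `k`-th column `u` satisfies
`u − Pu = e_k − π_k 1`; at a maximiser `j ≠ k` of `u` the left side is `≥ 0` while the right side is
`−π_k < 0`. [cite: KirklandNeumann2012, §2.5 Proposition 2.5.1 ([94]); §5.3 proof of Theorem
5.3.5 (b) ("for each index `k`, the maximum entry in `Q#e_k` is `q#_{k,k}`")] -/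
theorem groupInv_apply_le_diag (hP : IsRowStochastic P) (hπ : ∀ x, 0 < π x) (hπ1 : ∑ x, π x = 1)
    (hst : IsStationary π P) (hK : IsUnit (1 - (P - limitMatrix π))) (i k : X) :
    groupInv π P i k ≤ groupInv π P k k := by
  set u : X → ℝ := fun j => groupInv π P j k with hu
  have hcol : ∀ j, u j - ∑ l, P j l * u l = (if j = k then 1 else 0) - π k := by
    intro j
    have h := congrFun (congrFun (one_sub_mul_groupInv hP hπ1 hst hK) j) k
    rw [Matrix.sub_mul, Matrix.one_mul, Matrix.sub_apply, Matrix.mul_apply, Matrix.sub_apply,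
      Matrix.one_apply] at h
    simpa [limitMatrix] using h
  obtain ⟨j₀, -, hj₀⟩ := exists_max_image univ u ⟨k, mem_univ k⟩
  suffices h : u j₀ ≤ u k from (hj₀ i (mem_univ i)).trans h
  by_contra hlt
  rw [not_le] at hlt
  have hne : j₀ ≠ k := fun h => by rw [h] at hlt; exact lt_irrefl _ hlt
  have h1 := hcol j₀
  rw [if_neg hne, zero_sub] at h1
  have h2 : ∑ l, P j₀ l * u l ≤ u j₀ :=
    calc ∑ l, P j₀ l * u l ≤ ∑ l, P j₀ l * u j₀ :=
          sum_le_sum fun l _ => mul_le_mul_of_nonneg_left (hj₀ l (mem_univ l)) (hP.1 j₀ l)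
      _ = u j₀ := by rw [← sum_mul, hP.2 j₀, one_mul]
  linarith [hπ k]

/-- THE CONDITION NUMBER `κ(T) = ½ max_{i,j} (q#_jj − q#_ij)` (= `½ max_{i≠j} m_ij/m_jj` in mean
first passage times, Remark 5.3.6). [cite: KirklandNeumann2012, §5.3 eq. (5.15)] -/
noncomputable def condKappa (π : X → ℝ) (P : Matrix X X ℝ) : ℝ :=
  (1 / 2) * ⨆ p : X × X, (groupInv π P p.2 p.2 - groupInv π P p.1 p.2)

/-- **THEOREM 5.3.5 (b) — HAVIV–VAN DER HEYDEN's ENTRYWISE BOUND**: `|π̃_k − π_k| ≤ ‖E‖_∞ κ(T)`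
for every state `k`. [cite: KirklandNeumann2012, §5.3 Theorem 5.3.5 (b), eq. (5.17) (due to Haviv
and Van der Heyden [53]; equality is attained in Example 5.3.8)]; [cite: HavivVanderheyden1984,
(original of (5.17) — restated and proved in KirklandNeumann2012 Thm 5.3.5 (b); original not read)] -/
theorem abs_sub_apply_le_mul_condKappa (hP : IsRowStochastic P) (hπ : ∀ x, 0 < π x)
    (hπ1 : ∑ x, π x = 1) (hst : IsStationary π P) (hK : IsUnit (1 - (P - limitMatrix π)))
    (hπ'0 : ∀ x, 0 ≤ π' x) (hπ'1 : ∑ x, π' x = 1) (hst' : IsStationary π' P')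
    {ε : ℝ} (hE : ∀ x, ∑ y, |P' x y - P x y| ≤ ε) (k : X) :
    |π' k - π k| ≤ ε * condKappa π P := by
  have hid := sub_eq_vecMul_vecMul_groupInv hP hπ1 hst hK hπ'1 hst'
  set u := π' ᵥ* (P' - P) with hu
  have hbdd : BddAbove (Set.range fun p : X × X => groupInv π P p.2 p.2 - groupInv π P p.1 p.2) :=
    (Set.finite_range _).bddAbove
  have hκ : ∀ j, groupInv π P k k - groupInv π P j k ≤ 2 * condKappa π P := fun j => by
    have h := le_ciSup hbdd (j, k)
    unfold condKappa
    linarith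
  have hκ0 : 0 ≤ condKappa π P := by linarith [hκ k]
  have hz : ∀ i j, groupInv π P i k - groupInv π P j k ≤ 2 * condKappa π P := fun i j =>
    (sub_le_sub_right (groupInv_apply_le_diag hP hπ hπ1 hst hK i k) _).trans (hκ j)
  calc |π' k - π k| = |∑ i, u i * groupInv π P i k| := by
        rw [show π' k - π k = (π' - π) k from rfl, hid, vecMul_apply']
    _ ≤ (∑ i, |u i|) / 2 * (2 * condKappa π P) :=
        abs_sum_mul_le_of_sum_eq_zero (sum_vecMul_sub_eq_zero hP hst') hz
    _ = (∑ i, |u i|) * condKappa π P := by ring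
    _ ≤ ε * condKappa π P :=
        mul_le_mul_of_nonneg_right (norm_vecMul_sub_le hπ'0 hπ'1 hE) hκ0

end Bounds

/-! ## Seneta's bound under a Doeblin constant -/

section Doeblin

variable {P P' : Matrix X X ℝ} {π π' : X → ℝ}

/-- Seneta's bound under a DOEBLIN constant: `τ(P) ≤ 1 − δ`, `δ > 0` ⇒ `‖π̃ − π‖₁ ≤ ‖E‖_∞ / δ`
and `‖π̃ − π‖_TV ≤ ‖E‖_∞ / (2δ)`. [cite: FasinoTudisco2020, §4.1 Theorems 2 and 4] -/
theorem tvDist_le_div_of_ergodicCoeff_le (hπ1 : ∑ x, π x = 1)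
    (hst : IsStationary π P) (hπ'0 : ∀ x, 0 ≤ π' x) (hπ'1 : ∑ x, π' x = 1)
    (hst' : IsStationary π' P') {δ : ℝ} (hδ : 0 < δ) (hτ : ergodicCoeff P ≤ 1 - δ) {ε : ℝ}
    (hE : ∀ x, ∑ y, |P' x y - P x y| ≤ ε) :
    ∑ y, |π' y - π y| ≤ ε / δ ∧ tvDist π' π ≤ ε / (2 * δ) := by
  haveI := nonempty_of_sum_eq_one hπ1
  obtain ⟨x₀⟩ := ‹Nonempty X›
  have hε : 0 ≤ ε := (sum_nonneg fun y _ => abs_nonneg _).trans (hE x₀)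
  have h := norm_sub_le_div_one_sub_ergodicCoeff hπ1 hst hπ'0 hπ'1 hst' (by linarith) hE
  have h2 : ε / (1 - ergodicCoeff P) ≤ ε / δ := div_le_div_of_nonneg_left hε hδ (by linarith)
  refine ⟨h.trans h2, ?_⟩
  unfold tvDist
  rw [show ε / (2 * δ) = 1 / 2 * (ε / δ) by ring]
  exact mul_le_mul_of_nonneg_left (h.trans h2) (by norm_num)

end Doeblin

/-! ## How large is `E` for an accept/reject kernel with a perturbed acceptance probability? -/

section RateKernel

/-- A RATE KERNEL: off the diagonal the rates `R x y` (proposal × acceptance), on the diagonal the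
remaining mass — the shape of every accept/reject chain (`mhKernel T π = rateKernel (mhRate T π)`).
[cite: AlquierEtAl2014, §2.1.1, proof of Corollary 2.3 (the displays for `P(θ, dθ′)` and
`P̂(θ, dθ′)`: point mass `1 − ∫h min(1,α)` at `θ` plus density `h(θ′|θ) min(1,α(θ,θ′))`)] -/
def rateKernel (R : X → X → ℝ) : Matrix X X ℝ :=
  fun x y => if y = x then 1 - ∑ z ∈ univ.erase x, R x z else R x y

/-- The Metropolis–Hastings kernel of `MetropolisHastings.lean` is the rate kernel of `mhRate`.
[cite: AlquierEtAl2014, §2.1.1, proof of Corollary 2.3 (the display for `P(θ, dθ′)`)];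
[cite: GubernatisKawashimaWerner2016, §2.5.1 (the three-case definition of `P_{ij}`)] -/
theorem mhKernel_eq_rateKernel (T : X → X → ℝ) (π : X → ℝ) :
    mhKernel T π = rateKernel (mhRate T π) := rfl

/-- Rows of a rate kernel sum to one. [cite: GubernatisKawashimaWerner2016, §2.5.1 (the
stochasticity computation)] -/
theorem sum_rateKernel (R : X → X → ℝ) (x : X) : ∑ y, rateKernel R x y = 1 := by
  rw [← add_sum_erase _ _ (mem_univ x)]
  have h1 : rateKernel R x x = 1 - ∑ z ∈ univ.erase x, R x z := if_pos rfl
  have h2 : ∑ y ∈ univ.erase x, rateKernel R x y = ∑ y ∈ univ.erase x, R x y :=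
    sum_congr rfl fun y hy => if_neg (ne_of_mem_erase hy)
  rw [h1, h2]
  ring

/-- **KERNEL PERTURBATION FROM RATE PERTURBATION**: two rate kernels differ, row by row in `ℓ¹`,
by at most twice the `ℓ¹` difference of their off-diagonal rates (the diagonal compensates).
[cite: AlquierEtAl2014, proof of Corollary 2.3 ("`‖P − P̂‖ = ½ sup_θ ∫|P − P̂|(θ, dθ′) … ≤
sup_θ ∫dθ′ h(θ′|θ) |min(1, α(θ,θ′)) − min(1, α̂(θ,θ′,y′))|`")] -/
theorem rowDiff_rateKernel_le (R R' : X → X → ℝ) (x : X) :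
    ∑ y, |rateKernel R' x y - rateKernel R x y| ≤ 2 * ∑ z ∈ univ.erase x, |R' x z - R x z| := by
  rw [← add_sum_erase _ _ (mem_univ x)]
  have h1 : rateKernel R' x x - rateKernel R x x
      = ∑ z ∈ univ.erase x, (R x z - R' x z) := by
    have e1 : rateKernel R' x x = 1 - ∑ z ∈ univ.erase x, R' x z := if_pos rfl
    have e2 : rateKernel R x x = 1 - ∑ z ∈ univ.erase x, R x z := if_pos rfl
    rw [e1, e2, sum_sub_distrib]
    ring
  have h2 : ∑ y ∈ univ.erase x, |rateKernel R' x y - rateKernel R x y|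
      = ∑ y ∈ univ.erase x, |R' x y - R x y| :=
    sum_congr rfl fun y hy => by simp only [rateKernel, if_neg (ne_of_mem_erase hy)]
  rw [h1, h2]
  have h3 : |∑ z ∈ univ.erase x, (R x z - R' x z)| ≤ ∑ z ∈ univ.erase x, |R' x z - R x z| :=
    (abs_sum_le_sum_abs _ _).trans (le_of_eq (sum_congr rfl fun z _ => abs_sub_comm _ _))
  linarith

/-- **NOISY / APPROXIMATE ACCEPTANCE** (Alquier–Friel–Everitt–Boland): for a common proposal
`T ≥ 0` with row sums `≤ 1` and two acceptance-probability functions `a, â` with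
`|â(x,y) − a(x,y)| ≤ δ`, the accept/reject kernels satisfy `‖K̂(x,·) − K(x,·)‖₁ ≤ 2δ`, i.e.
`‖K̂ − K‖ ≤ δ` in the kernel total-variation norm. [cite: AlquierEtAl2014, §2.1.1 Corollary 2.3
(hypothesis (H2) `E|α̂ − α| ≤ δ(θ,θ′)`) and its proof ("`‖P − P̂‖ ≤ sup_θ ∫dθ′ h(θ′|θ) δ(θ,θ′)`")] -/
theorem rowDiff_rateKernel_accept_le {T a a' : X → X → ℝ} (hT0 : ∀ x y, 0 ≤ T x y)
    (hT1 : ∀ x, ∑ y, T x y ≤ 1) {δ : ℝ} (hδ : ∀ x y, |a' x y - a x y| ≤ δ) (x : X) :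
    ∑ y, |rateKernel (fun x y => T x y * a' x y) x y - rateKernel (fun x y => T x y * a x y) x y|
      ≤ 2 * δ := by
  have hδ0 : 0 ≤ δ := (abs_nonneg _).trans (hδ x x)
  refine (rowDiff_rateKernel_le _ _ x).trans ?_
  have h1 : ∑ z ∈ univ.erase x, |T x z * a' x z - T x z * a x z| ≤ ∑ z ∈ univ.erase x, T x z * δ :=
    sum_le_sum fun z _ => by
      rw [← mul_sub, abs_mul, abs_of_nonneg (hT0 x z)]
      exact mul_le_mul_of_nonneg_left (hδ x z) (hT0 x z)
  have h2 : ∑ z ∈ univ.erase x, T x z * δ ≤ δ := by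
    rw [← sum_mul]
    calc (∑ z ∈ univ.erase x, T x z) * δ ≤ (∑ z, T x z) * δ :=
          mul_le_mul_of_nonneg_right (sum_le_sum_of_subset_of_nonneg (erase_subset _ _)
            fun z _ _ => hT0 x z) hδ0
      _ ≤ 1 * δ := mul_le_mul_of_nonneg_right (hT1 x) hδ0
      _ = δ := one_mul δ
  linarith

end RateKernel

/-! ## The Kemeny constant `trace Q#` is a condition number (KN Corollary 5.3.9) -/

section Kemeny

variable {π π' : X → ℝ} {P P' : Matrix X X ℝ}

/-- Diagonal entries of the group inverse are non-negative: `0 = Σ_i π_i q#_ik ≤ Σ_i π_i q#_kk = q#_kk`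
(`πQ# = 0` and Proposition 2.5.1). [cite: KirklandNeumann2012, §2.5 Proposition 2.5.1 with §6.1
(`wᵗQ# = 0ᵗ`)] -/
theorem groupInv_diag_nonneg (hP : IsRowStochastic P) (hπ : ∀ x, 0 < π x) (hπ1 : ∑ x, π x = 1)
    (hst : IsStationary π P) (hK : IsUnit (1 - (P - limitMatrix π))) (k : X) :
    0 ≤ groupInv π P k k := by
  have h0 : ∑ i, π i * groupInv π P i k = 0 := by
    have h := congrFun (vecMul_groupInv_self hπ1 hst hK) k
    rwa [vecMul_apply'] at h
  have h1 : ∑ i, π i * groupInv π P i k ≤ ∑ i, π i * groupInv π P k k :=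
    sum_le_sum fun i _ =>
      mul_le_mul_of_nonneg_left (groupInv_apply_le_diag hP hπ hπ1 hst hK i k) (hπ i).le
  rw [h0, ← sum_mul, hπ1, one_mul] at h1
  exact h1

/-- **KN COROLLARY 5.3.9 (first half of its proof)**: `τ(Q#) ≤ trace Q#` — for any two rows
`½ Σ_k |q#_ik − q#_jk| = Σ_k max(q#_ik, q#_jk) ≤ Σ_k q#_kk` (zero row sums and Proposition 2.5.1);
`trace Q# = Σ_{k≥2} 1/(1 − λ_k)` is the KEMENY CONSTANT of the chain. [cite: KirklandNeumann2012,
§5.3 Corollary 5.3.9 (Seneta [108]) and its proof ("`½Σ_k |q#_ik − q#_jk| ≤ Σ_k q#_kk = trace(Q#)`")] -/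
theorem ergodicCoeff_groupInv_le_trace (hP : IsRowStochastic P) (hπ : ∀ x, 0 < π x)
    (hπ1 : ∑ x, π x = 1) (hst : IsStationary π P) (hK : IsUnit (1 - (P - limitMatrix π))) :
    ergodicCoeff (groupInv π P) ≤ Matrix.trace (groupInv π P) := by
  have htr : Matrix.trace (groupInv π P) = ∑ k, groupInv π P k k := rfl
  refine ergodicCoeff_le (htr ▸ sum_nonneg fun k _ => groupInv_diag_nonneg hP hπ hπ1 hst hK k)
    fun i j => ?_
  have hmax : ∀ k, |groupInv π P i k - groupInv π P j k|
      = 2 * max (groupInv π P i k) (groupInv π P j k) - groupInv π P i k - groupInv π P j k := by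
    intro k
    rw [← max_sub_min_eq_abs']
    linarith [min_add_max (groupInv π P i k) (groupInv π P j k)]
  rw [sum_congr rfl fun k (_ : k ∈ univ) => hmax k, sum_sub_distrib, sum_sub_distrib, ← mul_sum,
    sum_groupInv_row hP hπ1 hK i, sum_groupInv_row hP hπ1 hK j, sub_zero, sub_zero, htr]
  exact mul_le_mul_of_nonneg_left (sum_le_sum fun k _ =>
    max_le (groupInv_apply_le_diag hP hπ hπ1 hst hK i k) (groupInv_apply_le_diag hP hπ hπ1 hst hK j k))
    (by norm_num)

/-- Hence the Kemeny constant is a condition number: `‖π̃ − π‖₁ ≤ ‖E‖_∞ · trace Q#`.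
[cite: KirklandNeumann2012, §5.3 Corollary 5.3.9 ("`‖w̃ − w‖₁ ≤ ‖E‖_∞ Σ_{k=2}^n 1/(1 − λ_k)`")] -/
theorem norm_sub_le_mul_trace_groupInv (hP : IsRowStochastic P) (hπ : ∀ x, 0 < π x)
    (hπ1 : ∑ x, π x = 1) (hst : IsStationary π P) (hK : IsUnit (1 - (P - limitMatrix π)))
    (hπ'0 : ∀ x, 0 ≤ π' x) (hπ'1 : ∑ x, π' x = 1) (hst' : IsStationary π' P')
    {ε : ℝ} (hE : ∀ x, ∑ y, |P' x y - P x y| ≤ ε) :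
    ∑ y, |π' y - π y| ≤ ε * Matrix.trace (groupInv π P) := by
  haveI := nonempty_of_sum_eq_one hπ1
  obtain ⟨x₀⟩ := ‹Nonempty X›
  have hε : 0 ≤ ε := (sum_nonneg fun y _ => abs_nonneg _).trans (hE x₀)
  exact (norm_sub_le_mul_ergodicCoeff_groupInv hP hπ1 hst hK hπ'0 hπ'1 hst' hE).trans
    (mul_le_mul_of_nonneg_left (ergodicCoeff_groupInv_le_trace hP hπ hπ1 hst hK) hε)

end Kemeny

end Literature.Probability.MarkovChains
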